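import Literature.AlgebraicGeometry.HodgeTheory.MotivatedClassesDeformationInputs
import Literature.AlgebraicGeometry.HodgeTheory.GlobalInvariantCyclesSectionsProofs
import Literature.AlgebraicGeometry.HodgeTheory.GlobalInvariantCycles
import Literature.AlgebraicGeometry.HodgeTheory.MotivatedClassesDeformation
import HarnessLib

/-!
# Crux `HeckePrymAnchors` (stmt-HodgeConjecture-14496), line `Sketch` — stub `stub_globalClassOfSection`: the global class of a flat section

The W-engine of the crux on the tree's real carriers. Let `f : 𝒳 ⟶ S` be a smooth projective family
(`IsSmoothProjectiveFamily f n`), projective over `S` in Hartshorne's sense (a closed `S`-immersion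
into `ℙᴺ × S`), over a smooth quasi-projective IRREDUCIBLE complex base, and let
`σ : S(ℂ) → FiberClass f k` be a continuous section of the espace étalé of `Rᵏ f_* ℂ`
(`FiberClass.pt ∘ σ = id`). GRANTED Deligne's théorème de la partie fixe (the tree's named fact
`deligne_globalInvariantCycles`, as a hypothesis) and Hironaka's smooth projective compactification (the
body of the tree's named fact `Hironaka1964_smoothCompactification`, as a hypothesis), there is ONE
global class `W ∈ Hᵏ(𝒳(ℂ); ℂ)` of the open total space with `σ(s) = (s, W|_{𝒳_s})` for EVERY `s`.

Proof (three proved tree steps):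
1. the total space is smooth quasi-projective irreducible, so Hironaka gives an open immersion
   `i : 𝒳 ⟶ 𝒳̄` into a smooth projective `𝒳̄` (`Andre1996_deformation_hcomp_of_hironaka`);
2. Deligne's fact at ONE point `s₀ ∈ S(ℂ)` (non-empty: `S` is irreducible, so `S(ℂ)` is connected,
   `ComplexPoints.connectedSpace_iff_holds`) gives `A ∈ Hᵏ(𝒳̄(ℂ); ℂ)` with `σ(s₀) = (s₀, A|_{𝒳_{s₀}})`;
   put `W := i^* A`;
3. **identity principle for continuous sections** (`gcs_section_eq_of_eq`): `Rᵏ f_* ℂ` is a local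
   system on the connected manifold `S(ℂ)` (Ehresmann,
   `isCohomologicallyLocallyTrivialOn_univ_of_isSmoothProjectiveFamily`; equidimensionality
   `exists_smoothOfRelativeDimension_of_connectedSpace_complexPoints`; path-connectedness
   `pathConnectedSpace_complexPoints_of_smoothOfRelativeDimension`), continuous sections are flat
   (`transportFun_clsAt_of_continuous`, Voisin II Lemma 4.17), so `σ` and the continuous section
   `globalSection f k W` (`continuous_globalSection`), agreeing at `s₀`, agree everywhere.

No `sorry`, no new axiom; the two named facts enter only as hypotheses of the statement.

References: [DeligneHodgeII1971] Thm. 4.1.1; [CharlesSchnell2014Notes] Thm. 11.3.4;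
[VoisinHodgeII2003] Lemma 4.17, §3.1.2; [VoisinHodgeI2002] Thm. 9.3, §9.2.1; [Hironaka1964] Main Thm. I.
-/

noncomputable section

-- every declaration of this problem lives in `Summit.HodgeConjecture.HodgeConjecture.…` (summit = sub-problem)
set_option linter.dupNamespace false

open CategoryTheory AlgebraicGeometry Limits MonoidalCategory CartesianMonoidalCategory

namespace Summit.HodgeConjecture.HodgeConjecture.Theorems.HeckePrymWeilLine

open Literature.AlgebraicGeometry Literature.AlgebraicGeometry.Motives Literature.AlgebraicGeometry.HodgeTheory

/-! ## Identity principle for continuous sections of the espace étalé `FiberClass f k → S(ℂ)` -/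

/-- **Continuous sections of a local system over a path-connected base are determined by one value.**
If `f : 𝒳 ⟶ S` is cohomologically locally trivial by restriction over all of `S(ℂ)` (`Rᵏ f_* ℂ` is a
local system) and `S(ℂ)` is path connected, two continuous sections `σ`, `τ` of
`FiberClass.pt : FiberClass f k → S(ℂ)` with `σ s₀ = τ s₀` agree at every `s`: join `s₀` to `s` by a
path `γ`; continuous sections are flat (`transportFun_clsAt_of_continuous`, Voisin II Lemma 4.17), so
both `σ s` and `τ s` are the transport `γ_*` of the common value at `s₀`.
(Cf. `fiberClass_section_eq_of_eq` in `Theorems/PadicSemiregularLiftHodgeAbelianVarietiesStubCmAnchoredFamilies`,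
the same principle with the base hypotheses of a smooth projective family built in.) -/
theorem gcs_section_eq_of_eq {𝒳 S : SchemeOver ℂ} (f : 𝒳 ⟶ S) (k : ℕ)
    (hU : IsCohomologicallyLocallyTrivialOn f (Set.univ : Set (ComplexPoints S)))
    [PathConnectedSpace (ComplexPoints S)] {σ τ : ComplexPoints S → FiberClass f k}
    (hσ : Continuous σ) (hσpt : ∀ s, (σ s).pt = s) (hτ : Continuous τ) (hτpt : ∀ s, (τ s).pt = s)
    {s₀ : ComplexPoints S} (h₀ : σ s₀ = τ s₀) (s : ComplexPoints S) : σ s = τ s := by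
  -- a path from `s₀` to `s`, viewed in the subtype `univ` over which transport is defined
  have hcont : Continuous fun x : ComplexPoints S =>
      (⟨x, Set.mem_univ x⟩ : (Set.univ : Set (ComplexPoints S))) := continuous_id.subtype_mk _
  let γ : Path (⟨s₀, Set.mem_univ s₀⟩ : (Set.univ : Set (ComplexPoints S))) ⟨s, Set.mem_univ s⟩ :=
    (PathConnectedSpace.somePath s₀ s).map hcont
  -- both sections are flat along `γ`
  have h1 : transportFun f k hU ⟦γ⟧ ((σ s₀).clsAt (hσpt s₀)) = (σ s).clsAt (hσpt s) :=
    transportFun_clsAt_of_continuous f k hU hσ hσpt γ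
  have h2 : transportFun f k hU ⟦γ⟧ ((τ s₀).clsAt (hτpt s₀)) = (τ s).clsAt (hτpt s) :=
    transportFun_clsAt_of_continuous f k hU hτ hτpt γ
  -- the common value at `s₀`
  have e₀ : (σ s₀).clsAt (hσpt s₀) = (τ s₀).clsAt (hτpt s₀) :=
    (FiberClass.clsAt_eq_iff _ _ _).2 (h₀.trans (FiberClass.mk_clsAt _ _).symm)
  rw [e₀, h2] at h1
  -- hence the same value at `s`
  rw [← FiberClass.mk_clsAt (σ s) (hσpt s), ← h1, FiberClass.mk_clsAt]

/-! ## The stub: the global class of a flat section -/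

/-- **GLOBAL CLASS OF A FLAT SECTION** (the W-engine on real carriers). Granted the partie fixe
(`deligne_globalInvariantCycles`, Deligne Hodge II Thm. 4.1.1 / Charles–Schnell Thm. 11.3.4) and
Hironaka's smooth projective compactification (the body of `Hironaka1964_smoothCompactification`),
every continuous section `σ` of `FiberClass f k → S(ℂ)` of an embedded smooth projective family
`f : 𝒳 ⟶ S` over a smooth quasi-projective irreducible base is the global section of ONE class
`W ∈ Hᵏ(𝒳(ℂ); ℂ)` of the OPEN total space: compactify `𝒳 ↪ 𝒳̄`
(`Andre1996_deformation_hcomp_of_hironaka`), apply Deligne's fact at one point `s₀` to get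
`W = i^* A` with `σ s₀ = (s₀, W|_{𝒳_{s₀}})`, and conclude by the identity principle for continuous
sections over the connected `S(ℂ)` (`gcs_section_eq_of_eq` with Ehresmann's local triviality
`isCohomologicallyLocallyTrivialOn_univ_of_isSmoothProjectiveFamily`). -/
theorem stub_globalClassOfSection :
    deligne_globalInvariantCycles →
    (∀ (m : ℕ) (T : SchemeOver ℂ), SmoothOfRelativeDimension m T.hom →
      IsQuasiProjectiveOver T → IrreducibleSpace T.left →
      ∃ (Tbar : SchemeOver ℂ) (i : T ⟶ Tbar), IsSmoothProjective m Tbar ∧ IsOpenImmersion i.left) →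
    ∀ ⦃𝒳 S : SchemeOver ℂ⦄ (f : 𝒳 ⟶ S) (n k : ℕ), IsSmoothProjectiveFamily f n →
      (∃ (N : ℕ) (ι : 𝒳 ⟶ projectiveSpace N ℂ ⊗ S),
          IsClosedImmersion ι.left ∧ ι ≫ snd (projectiveSpace N ℂ) S = f) →
      AlgebraicGeometry.Smooth S.hom → IsQuasiProjectiveOver S → IrreducibleSpace S.left →
      ∀ (σ : ComplexPoints S → FiberClass f k), Continuous σ → (∀ s, (σ s).pt = s) →
        ∃ W : complexBetti 𝒳 k, ∀ s, σ s = globalSection f k W s := by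
  intro hD hHir 𝒳 S f n k hf hι hS hSqp hSirr σ hσ hpt
  -- (1) a smooth projective compactification of the total space
  obtain ⟨m, Xbar, i, hXbar, hi⟩ := Andre1996_deformation_hcomp_of_hironaka hHir f hf hι hS hSqp hSirr
  -- the base: `S(ℂ)` is a connected manifold, `Rᵏ f_* ℂ` a local system on it
  haveI := hS
  haveI := hSirr
  haveI : LocallyOfFiniteType S.hom := hSqp.locallyOfFiniteType
  haveI : ConnectedSpace (ComplexPoints S) := (ComplexPoints.connectedSpace_iff_holds S).2 inferInstance
  obtain ⟨d, hd⟩ := exists_smoothOfRelativeDimension_of_connectedSpace_complexPoints S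
  haveI := hd
  haveI := pathConnectedSpace_complexPoints_of_smoothOfRelativeDimension S d
  have hU := isCohomologicallyLocallyTrivialOn_univ_of_isSmoothProjectiveFamily f d hf hSqp
  -- (2) the partie fixe at one point `s₀`
  obtain ⟨s₀⟩ := (inferInstance : Nonempty (ComplexPoints S))
  obtain ⟨A, hA⟩ := hD 𝒳 Xbar S f i n m hf hSqp hS hXbar.isProjectiveOver
    hXbar.smoothOfRelativeDimension hi k σ hσ hpt s₀
  -- (3) uniqueness of continuous sections
  exact ⟨complexBetti.map i k A, gcs_section_eq_of_eq f k hU hσ hpt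
    (continuous_globalSection f k _) (fun _ => rfl) hA⟩

end Summit.HodgeConjecture.HodgeConjecture.Theorems.HeckePrymWeilLine

end
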